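import Mathlib.Topology.UnitInterval
import Mathlib.Topology.Connected.Basic
import Mathlib.Topology.Order.IntermediateValue
import Mathlib.Topology.Maps.Proper.Basic
import HarnessLib

/-!
# Traversal order of an injective curve whose trace is `Head ∪ Z[u₁,v₁] ∪ Tail`

Support file for item `stmt-CriticalPhenomena-18057` (`AttachNoReturn`, route `SAWReversalUpgrade`,
sub-problem `SAWScalingLimit`). Pure point-set topology, no lattice or conformal input.

Setting: `att : unitInterval → X` continuous and injective (`X` Hausdorff), `att 0 = a`,
`att 1 = b`, and `range att = Head ∪ Z '' Icc u₁ v₁ ∪ Tail`, where `Z` is continuous on `[u₁, v₁]`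
and FLAT there (equal values at `u ≤ u'` force constancy on `[u, u']` — the only non-injectivity a
lattice polyline has), `Z u₁ = Ja`, `Z v₁ = Jb ∈ Tail`, `Head ∋ a` and
`Tail ∋ b` are preconnected, `Ja ∉ Tail`, `Jb ∉ Head`, and `Head \ {Ja}` (resp. `Tail \ {Jb}`) is
preconnected and contains `a` (resp. `b`) unless `Head ⊆ {a}` (resp. `Tail ⊆ {b}`).

Conclusion (`arc_order`): with `ta = att⁻¹ Ja`, `tb = att⁻¹ Jb` one has `ta < tb`; times `< ta` are
spent in `Head \ {Ja}`, times `> tb` in `Tail \ {Jb}`; `Head` is left by time `ta` and `Tail` is not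
entered before `tb`; and two middle points met in the order `att s`, `att t` (`s < t`) are
`Z σ`, `Z τ` with `σ < τ` — the middle arc is traversed in the order of `Z`. The proofs only use
that the `att`-preimage of a preconnected subset of the trace is an interval (a continuous injection
of a compact space is a closed embedding) and order-convexity of preconnected sets.
-/

namespace Summit.CriticalPhenomena.SAWScalingLimit.Theorems.AttachNoReturn

open Set Function Topology

section Arc

variable {X : Type*} [TopologicalSpace X] [T2Space X]

/-- A preconnected subset of `unitInterval` is order-convex. -/
theorem mem_of_isPreconnected {Q : Set unitInterval} (hQ : IsPreconnected Q) {x y z : unitInterval}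
    (hx : x ∈ Q) (hy : y ∈ Q) (hxz : x ≤ z) (hzy : z ≤ y) : z ∈ Q := by
  have hQ' : IsPreconnected (Subtype.val '' Q) :=
    hQ.image _ continuous_subtype_val.continuousOn
  have hsub := hQ'.Icc_subset (mem_image_of_mem _ hx) (mem_image_of_mem _ hy)
  have hz : (z : ℝ) ∈ Icc (x : ℝ) y := ⟨Subtype.coe_le_coe.mpr hxz, Subtype.coe_le_coe.mpr hzy⟩
  obtain ⟨q, hq, hqz⟩ := hsub hz
  have : q = z := Subtype.ext hqz
  exact this ▸ hq

/-- The preimage under a continuous injective curve of a preconnected subset of its trace is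
preconnected (the curve is a closed embedding of the compact interval). -/
theorem isPreconnected_preimage {att : unitInterval → X} (hc : Continuous att)
    (hi : Injective att) {C : Set X} (hC : IsPreconnected C) (hCr : C ⊆ range att) :
    IsPreconnected (att ⁻¹' C) :=
  hC.preimage_of_isClosedMap hi (hc.isClosedEmbedding hi).isClosedMap hCr

variable {att : unitInterval → X} {a b Ja Jb : X} {Head Tail : Set X} {Z : ℝ → X} {u₁ v₁ : ℝ}

/-- **Order along the arc.** See the module docstring: the decomposition
`range att = Head ∪ Z '' Icc u₁ v₁ ∪ Tail` of the trace of a continuous injective curve from `a` to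
`b`, with a flat continuous middle piece `Z` from `Ja` to `Jb` and preconnected end pieces,
forces the traversal order: first `Head`, then the middle piece in the order of `Z`, then `Tail`. -/
theorem arc_order (hc : Continuous att) (hi : Injective att)
    (h0 : att 0 = a) (h1 : att 1 = b)
    (hrange : range att = Head ∪ Z '' Icc u₁ v₁ ∪ Tail)
    (hZ : ContinuousOn Z (Icc u₁ v₁)) (huv : u₁ ≤ v₁) (hZu : Z u₁ = Ja) (hZv : Z v₁ = Jb)
    (hflat : ∀ u ∈ Icc u₁ v₁, ∀ u' ∈ Icc u₁ v₁, u ≤ u' → Z u = Z u' → ∀ w ∈ Icc u u', Z w = Z u)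
    (haH : a ∈ Head) (hbT : b ∈ Tail) (hJbT : Jb ∈ Tail)
    (hJaT : Ja ∉ Tail) (hJbH : Jb ∉ Head)
    (hHc : IsPreconnected Head) (hTc : IsPreconnected Tail)
    (hH' : (a ∈ Head \ {Ja} ∧ IsPreconnected (Head \ {Ja})) ∨ Head ⊆ {a})
    (hT' : (b ∈ Tail \ {Jb} ∧ IsPreconnected (Tail \ {Jb})) ∨ Tail ⊆ {b}) :
    ∃ ta tb : unitInterval, ta < tb ∧ att ta = Ja ∧ att tb = Jb ∧
      (∀ t, t < ta → att t ∈ Head \ {Ja}) ∧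
      (∀ t, tb < t → att t ∈ Tail \ {Jb}) ∧
      (∀ t, att t ∈ Head → t ≤ ta) ∧
      (∀ t, att t ∈ Tail → tb ≤ t) ∧
      (∀ s t, s < t → att s ∈ Z '' Icc u₁ v₁ → att t ∈ Z '' Icc u₁ v₁ →
        ∃ x ∈ Icc u₁ v₁, ∃ y ∈ Icc u₁ v₁, x < y ∧ Z x = att s ∧ Z y = att t) := by
  -- order facts on `unitInterval`
  have zero_le' : ∀ t : unitInterval, (0 : unitInterval) ≤ t := fun t =>
    Subtype.coe_le_coe.mp (by simpa using t.2.1)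
  have le_one'' : ∀ t : unitInterval, t ≤ (1 : unitInterval) := fun t =>
    Subtype.coe_le_coe.mp (by simpa using t.2.2)
  -- the pieces of the trace
  have hHr : Head ⊆ range att := by
    rw [hrange]; exact subset_union_left.trans subset_union_left
  have hMr : Z '' Icc u₁ v₁ ⊆ range att := by
    rw [hrange]; exact subset_union_right.trans subset_union_left
  have hTr : Tail ⊆ range att := by rw [hrange]; exact subset_union_right
  have hu₁ : u₁ ∈ Icc u₁ v₁ := left_mem_Icc.2 huv
  have hv₁ : v₁ ∈ Icc u₁ v₁ := right_mem_Icc.2 huv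
  -- the two junction times
  obtain ⟨ta, hta⟩ : ∃ ta, att ta = Ja := hMr ⟨u₁, hu₁, hZu⟩
  obtain ⟨tb, htb⟩ : ∃ tb, att tb = Jb := hMr ⟨v₁, hv₁, hZv⟩
  -- images of subintervals of the middle piece lie in the trace
  have hsubr : ∀ u u', u₁ ≤ u → u' ≤ v₁ → Z '' Icc u u' ⊆ range att := fun u u' hu hu' =>
    (image_mono (Icc_subset_Icc hu hu')).trans hMr
  have hsubc : ∀ u u', u₁ ≤ u → u' ≤ v₁ → ContinuousOn Z (Icc u u') := fun u u' hu hu' =>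
    hZ.mono (Icc_subset_Icc hu hu')
  have hpre : ∀ u u', u₁ ≤ u → u' ≤ v₁ → IsPreconnected (att ⁻¹' (Z '' Icc u u')) :=
    fun u u' hu hu' => isPreconnected_preimage hc hi
      (isPreconnected_Icc.image Z (hsubc u u' hu hu')) (hsubr u u' hu hu')
  -- (A1) `Tail` comes strictly after `ta`
  have hA1 : ∀ t, att t ∈ Tail → ta < t := by
    intro t ht
    by_contra h
    push Not at h
    have hQ : IsPreconnected (att ⁻¹' Tail) := isPreconnected_preimage hc hi hTc hTr
    have hone : (1 : unitInterval) ∈ att ⁻¹' Tail := by change att 1 ∈ Tail; rw [h1]; exact hbT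
    have : ta ∈ att ⁻¹' Tail := mem_of_isPreconnected hQ ht hone h (le_one'' ta)
    exact hJaT (by rw [← hta]; exact this)
  -- (A1') `Head` comes strictly before `tb`
  have hA1' : ∀ t, att t ∈ Head → t < tb := by
    intro t ht
    by_contra h
    push Not at h
    have hQ : IsPreconnected (att ⁻¹' Head) := isPreconnected_preimage hc hi hHc hHr
    have hzero : (0 : unitInterval) ∈ att ⁻¹' Head := by change att 0 ∈ Head; rw [h0]; exact haH
    have : tb ∈ att ⁻¹' Head := mem_of_isPreconnected hQ hzero ht (zero_le' tb) h
    exact hJbH (by rw [← htb]; exact this)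
  have hab : ta < tb := hA1 tb (by rw [htb]; exact hJbT)
  -- (A2) the middle piece is not met before `ta`
  have hA2 : ∀ u ∈ Icc u₁ v₁, ∀ t, att t = Z u → ta ≤ t := by
    intro u hu t htu
    by_contra h
    push Not at h
    -- `att ⁻¹' Z[u, v₁]` is an interval containing `t < ta < tb`, hence `ta`
    have hQ := hpre u v₁ hu.1 le_rfl
    have htQ : t ∈ att ⁻¹' (Z '' Icc u v₁) := ⟨u, left_mem_Icc.2 hu.2, htu.symm⟩
    have htbQ : tb ∈ att ⁻¹' (Z '' Icc u v₁) := ⟨v₁, right_mem_Icc.2 hu.2, by rw [hZv, htb]⟩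
    have htaQ : ta ∈ att ⁻¹' (Z '' Icc u v₁) := mem_of_isPreconnected hQ htQ htbQ h.le hab.le
    obtain ⟨u', hu', hu'a⟩ := htaQ
    -- `Z u' = Ja = Z u₁` with `u₁ ≤ u ≤ u'`: flatness forces `Z u = Ja`
    have hu'I : u' ∈ Icc u₁ v₁ := ⟨hu.1.trans hu'.1, hu'.2⟩
    have hZu' : Z u₁ = Z u' := by rw [hZu, hu'a, hta]
    have hZuJ : Z u = Ja := by
      rw [← hZu]; exact hflat u₁ hu₁ u' hu'I (hu.1.trans hu'.1) hZu' u ⟨hu.1, hu'.1⟩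
    have : att t = att ta := by rw [htu, hZuJ, hta]
    exact (lt_irrefl _) (hi this ▸ h)
  -- (A3) the middle piece is not met after `tb`
  have hA3 : ∀ u ∈ Icc u₁ v₁, ∀ t, att t = Z u → t ≤ tb := by
    intro u hu t htu
    by_contra h
    push Not at h
    have hQ := hpre u₁ u le_rfl hu.2
    have htQ : t ∈ att ⁻¹' (Z '' Icc u₁ u) := ⟨u, right_mem_Icc.2 hu.1, htu.symm⟩
    have htaQ : ta ∈ att ⁻¹' (Z '' Icc u₁ u) := ⟨u₁, left_mem_Icc.2 hu.1, by rw [hZu, hta]⟩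
    have htbQ : tb ∈ att ⁻¹' (Z '' Icc u₁ u) := mem_of_isPreconnected hQ htaQ htQ hab.le h.le
    obtain ⟨u', hu', hu'b⟩ := htbQ
    have hu'I : u' ∈ Icc u₁ v₁ := ⟨hu'.1, hu'.2.trans hu.2⟩
    have hZu' : Z u' = Z v₁ := by rw [hZv, hu'b, htb]
    have hZuJ : Z u = Jb := by
      have := hflat u' hu'I v₁ hv₁ hu'I.2 hZu' u ⟨hu'.2, hu.2⟩
      rw [this, hu'b, htb]
    have : att t = att tb := by rw [htu, hZuJ, htb]
    exact (lt_irrefl _) (hi this ▸ h)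
  -- membership in the trace, split three ways
  have hmem : ∀ t, att t ∈ Head ∨ att t ∈ Z '' Icc u₁ v₁ ∨ att t ∈ Tail := by
    intro t
    have : att t ∈ range att := mem_range_self t
    rw [hrange] at this
    rcases this with (h | h) | h
    · exact Or.inl h
    · exact Or.inr (Or.inl h)
    · exact Or.inr (Or.inr h)
  -- (A4) before `ta` the curve is in `Head \ {Ja}`
  have hA4 : ∀ t, t < ta → att t ∈ Head \ {Ja} := by
    intro t ht
    refine ⟨?_, fun h => (lt_irrefl _) (hi (h.trans hta.symm) ▸ ht)⟩
    rcases hmem t with h | ⟨u, hu, hut⟩ | h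
    · exact h
    · exact absurd (hA2 u hu t hut.symm) (not_le.2 ht)
    · exact absurd (hA1 t h) (not_lt.2 ht.le)
  -- (A5) after `tb` the curve is in `Tail \ {Jb}`
  have hA5 : ∀ t, tb < t → att t ∈ Tail \ {Jb} := by
    intro t ht
    refine ⟨?_, fun h => (lt_irrefl _) (hi (h.trans htb.symm) ▸ ht)⟩
    rcases hmem t with h | ⟨u, hu, hut⟩ | h
    · exact absurd (hA1' t h) (not_lt.2 ht.le)
    · exact absurd (hA3 u hu t hut.symm) (not_le.2 ht)
    · exact h
  -- (A6) `Head` is left by time `ta`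
  have hA6 : ∀ t, att t ∈ Head → t ≤ ta := by
    intro t ht
    rcases hH' with ⟨haH', hHc'⟩ | hHa
    · by_cases hJt : att t = Ja
      · exact (hi (hJt.trans hta.symm)).le
      · by_contra h
        push Not at h
        have hH'r : Head \ {Ja} ⊆ range att := fun x hx => hHr hx.1
        have hQ : IsPreconnected (att ⁻¹' (Head \ {Ja})) := isPreconnected_preimage hc hi hHc' hH'r
        have hzero : (0 : unitInterval) ∈ att ⁻¹' (Head \ {Ja}) := by
          change att 0 ∈ Head \ {Ja}; rw [h0]; exact haH'
        have htQ : t ∈ att ⁻¹' (Head \ {Ja}) := ⟨ht, hJt⟩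
        have : ta ∈ att ⁻¹' (Head \ {Ja}) := mem_of_isPreconnected hQ hzero htQ (zero_le' ta) h.le
        exact this.2 hta
    · have : att t = att 0 := by rw [h0]; exact hHa ht
      rw [hi this]
      exact zero_le' ta
  -- (A7) `Tail` is not entered before `tb`
  have hA7 : ∀ t, att t ∈ Tail → tb ≤ t := by
    intro t ht
    rcases hT' with ⟨hbT', hTc'⟩ | hTb
    · by_cases hJt : att t = Jb
      · exact (hi (hJt.trans htb.symm)).ge
      · by_contra h
        push Not at h
        have hT'r : Tail \ {Jb} ⊆ range att := fun x hx => hTr hx.1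
        have hQ : IsPreconnected (att ⁻¹' (Tail \ {Jb})) := isPreconnected_preimage hc hi hTc' hT'r
        have hone : (1 : unitInterval) ∈ att ⁻¹' (Tail \ {Jb}) := by
          change att 1 ∈ Tail \ {Jb}; rw [h1]; exact hbT'
        have htQ : t ∈ att ⁻¹' (Tail \ {Jb}) := ⟨ht, hJt⟩
        have : tb ∈ att ⁻¹' (Tail \ {Jb}) := mem_of_isPreconnected hQ htQ hone h.le (le_one'' tb)
        exact this.2 htb
    · have : att t = att 1 := by rw [h1]; exact hTb ht
      rw [hi this]
      exact le_one'' tb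
  -- (A8) the middle piece is traversed in the order of `Z`
  have hA8 : ∀ s t, s < t → att s ∈ Z '' Icc u₁ v₁ → att t ∈ Z '' Icc u₁ v₁ →
      ∃ x ∈ Icc u₁ v₁, ∃ y ∈ Icc u₁ v₁, x < y ∧ Z x = att s ∧ Z y = att t := by
    rintro s t hst ⟨us, hus, hZs⟩ ⟨ut, hut, hZt⟩
    rcases lt_trichotomy us ut with hlt | heq | hgt
    · exact ⟨us, hus, ut, hut, hlt, hZs, hZt⟩
    · exact absurd (hi (hZs.symm.trans (heq ▸ hZt))) hst.ne
    · -- `att s` is met by `Z` again before `ut`: `att ⁻¹' Z[u₁, ut] ∋ ta ≤ s < t`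
      have hsa : ta ≤ s := hA2 us hus s hZs.symm
      have hQ := hpre u₁ ut le_rfl hut.2
      have htaQ : ta ∈ att ⁻¹' (Z '' Icc u₁ ut) := ⟨u₁, left_mem_Icc.2 hut.1, by rw [hZu, hta]⟩
      have htQ : t ∈ att ⁻¹' (Z '' Icc u₁ ut) := ⟨ut, right_mem_Icc.2 hut.1, hZt⟩
      obtain ⟨x, hx, hZx⟩ : s ∈ att ⁻¹' (Z '' Icc u₁ ut) :=
        mem_of_isPreconnected hQ htaQ htQ hsa hst.le
      have hxt : x ≠ ut := by
        rintro rfl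
        exact hst.ne (hi (hZx.symm.trans hZt))
      exact ⟨x, ⟨hx.1, hx.2.trans hut.2⟩, ut, hut, lt_of_le_of_ne hx.2 hxt, hZx, hZt⟩
  exact ⟨ta, tb, hab, hta, htb, hA4, hA5, hA6, hA7, hA8⟩

end Arc

end Summit.CriticalPhenomena.SAWScalingLimit.Theorems.AttachNoReturn
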